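import Mathlib
import Literature.RingTheory.CohomologyAnnihilator.Basic
import Literature.RingTheory.KTheory.MilnorSquares
import HarnessLib

/-!
# The cohomology annihilator of branched covers and of reduced curve singularities (Esentepe)

Topic: `Literature/RingTheory/CohomologyAnnihilator`.  NAMED FACTS (statements only, no proofs) from
Ö. Esentepe, *The cohomology annihilator of a curve singularity*, J. Algebra 541 (2020) 359–379,
arXiv:1807.05471 [`Esentepe2020`], typed against the tree's cohomology annihilator
`cohomologyAnnihilator R = ⋃ₙ caⁿ(R)` (`Basic.lean`, [IyengarTakahashi2014, Def. 2.1]; the source's Definition 2.2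
(arXiv p. 4) uses `caⁿ(R) = ⋂ ann Extⁿ(M, N)` and `ca(R) = ⋃ₙ caⁿ(R)`, which agrees with the tree's ideal for
noetherian `R` by `mem_cohomologyAnnihilatorOfDegree_iff_of_isNoetherianRing`) and the tree's conductor ideal
`Literature.RingTheory.KTheory.conductorIdeal A A₁` (`{a ∈ A | a·A₁ ⊆ A}`; the source's `𝔠(R) = ann(R̄/R)`, arXiv p. 7,
is `conductorIdeal R R̄` with `R̄` the integral closure of `R` in its total ring of fractions `FractionRing R`).

Setting of §5.1 (arXiv p. 9): «Let `S = k⟦x₀, …, xₙ⟧` and `f ∈ (x₀, …, xₙ)`. Let `S♯ = S⟦y⟧`. Then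
`R♯ = S♯/(f + yᵐ)` is called the `m`-branched cover of `R = S/(f)`. Note that `R ≅ R♯/(y)` … Let `π : R♯ → R` be the
natural surjection.»  Here: `S = MvPowerSeries (Fin n) k` (any number `n` of variables), `f ∈ 𝔪_S` rendered as
`MvPowerSeries.constantCoeff f = 0`, `S♯ = PowerSeries S`, `R♯ = BranchedCover S f m := S⟦y⟧ ⧸ (C f + yᵐ)`, and
`π = branchedCoverProjection S f m : R♯ →+* S ⧸ (f)` induced by `y ↦ 0` (REAL definitions, below; this file
declares definitions and statement-only named facts, no theorems).

* `branchedCover_map_cohomologyAnnihilator_le` — NAMED FACT [Esentepe2020, Thm. 5.4, first sentence]: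
  `π(ca(R♯)) ⊆ ca(R)` for the `m`-branched cover, `m ≥ 2`;
* `doubleBranchedCover_map_cohomologyAnnihilator_eq` — NAMED FACT [Esentepe2020, Thm. 5.4, «When `m = 2`, there is
  equality»]: `π(ca(R♯)) = ca(R)` for the double branched cover, `char k ≠ 2`;
* `planeCurve_cohomologyAnnihilator_eq_conductor` — NAMED FACT [Esentepe2020, Thm. 4.4], SPECIAL CASE of reduced PLANE
  CURVE germs `k⟦z,t⟧/(h)`: `ca(R) = 𝔠(R)` (the source: every one-dimensional reduced complete Gorenstein local ring;
  the tree has no Gorenstein predicate, so only the hypersurface-curve case the requesting chain uses is typed —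
  `TODO(general form)` recorded in the docstring).

HYPOTHESES MADE EXPLICIT (typer's reading, flagged): (i) the equality for `m = 2` is proved in the source through
Knörrer's lemma [Esentepe2020, Lemma 5.2, citing Knörrer / Leuschke–Wiegand / Yoshino], stated there under «the
characteristic of `k` is not `2`», and through matrix factorisations of `f`, which need `f ≠ 0` — both are carried
as hypotheses of `doubleBranchedCover_map_cohomologyAnnihilator_eq`; (ii) «`m`-branched cover» is read with `m ≥ 2`
(for `m = 1`, `R♯ ≅ S` is regular and the inclusion fails at any singular `R`); the inclusion fact also carries
`char k ≠ 2`, the running hypothesis of §5.1 under which Remark 5.3 asserts the weak MCM extending property for all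
`m`.  Lemma 5.2 itself (Knörrer's periodicity isomorphisms `πΩ♯M ≅ M ⊕ ΩM`, `Ω♯πN ≅ N ⊕ Ω♯N`) is NOT typed here: it
needs maximal Cohen–Macaulay modules and syzygy functors up to projective summands, absent from the tree.

Requested by cell res-hironaka, chain W4.4b (res-L1-w44b-plan-1 FACT-LIST §A admission 2026-08-27T10:27:28Z, CUT «F-DP»
10:27:47Z) for the «cA arena» enabling formula `ca(k⟦x,y,z,t⟧/(xy − h)) = (x, y) + ca(k⟦z,t⟧/(h))`.  CAVEAT: typed by an
AI seat from the arXiv text (v2, pp. 4, 7, 9) and checked only by the Lean kernel for well-formedness; weaker than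
expert review of the rendering.

## References

* Ö. Esentepe, *The cohomology annihilator of a curve singularity*, J. Algebra 541 (2020) 359–379; arXiv:1807.05471:
  Def. 2.2, Thm. 4.3 (Wang), Thm. 4.4, §5.1, Lemma 5.2 (Knörrer), Remark 5.3, Thm. 5.4. [`Esentepe2020`]
* S. B. Iyengar, R. Takahashi, *Annihilation of cohomology and strong generation of module categories*, IMRN 2016:
  Def. 2.1. [`IyengarTakahashi2014`]
-/

noncomputable section

open PowerSeries

universe u

namespace Literature.RingTheory.CohomologyAnnihilator

/-! ## The `m`-branched cover and its projection (real definitions) -/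

/-- **The `m`-branched cover** `R♯ = S⟦y⟧ ⧸ (f + yᵐ)` of `R = S ⧸ (f)` [Esentepe2020, §5.1, arXiv p. 9]: for a
commutative ring `S`, `f ∈ S` and `m : ℕ`, the quotient of the power series ring `S⟦y⟧ = PowerSeries S` by the
principal ideal generated by `C f + yᵐ`.  (The source takes `S = k⟦x₀,…,xₙ⟧`, `f` in the maximal ideal; the
definition is stated for any `S`.) [cite: Esentepe2020, §5.1 (arXiv p. 9)] -/
abbrev BranchedCover (S : Type u) [CommRing S] (f : S) (m : ℕ) : Type u :=
  PowerSeries S ⧸ Ideal.span {(C f + X ^ m : PowerSeries S)}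

/-- **The natural surjection `π : R♯ → R`** [Esentepe2020, §5.1: «`R ≅ R♯/(y)` … Let `π : R♯ → R` be the natural
surjection»]: the ring homomorphism `S⟦y⟧ ⧸ (f + yᵐ) →+* S ⧸ (f)` induced by `y ↦ 0` (`PowerSeries.constantCoeff`
followed by the quotient map; the generator `C f + yᵐ` has constant coefficient `f` when `m ≠ 0`), for `m ≠ 0`.
On classes, `π (mk a) = mk (constantCoeff a)` definitionally. [cite: Esentepe2020, §5.1 (arXiv p. 9)] -/
def branchedCoverProjection (S : Type u) [CommRing S] (f : S) (m : ℕ) [NeZero m] :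
    BranchedCover S f m →+* S ⧸ Ideal.span {f} :=
  Ideal.Quotient.lift (Ideal.span {(C f + X ^ m : PowerSeries S)})
    ((Ideal.Quotient.mk (Ideal.span {f})).comp (constantCoeff (R := S))) fun _ ha =>
      (Ideal.mem_span_singleton'.mp ha).elim fun b hb =>
        hb ▸ (map_mul _ b _).trans (mul_eq_zero_of_right _ <|
          (congrArg (Ideal.Quotient.mk (Ideal.span {f}))
            ((map_add constantCoeff (C f) (X ^ m)).trans
              ((congrArg₂ (· + ·) (constantCoeff_C f)
                ((map_pow constantCoeff (X : PowerSeries S) m).trans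
                  ((congrArg (fun t : S => t ^ m) (constantCoeff_X (R := S))).trans
                    (zero_pow (NeZero.ne m))))).trans (add_zero f)))).trans
            (Ideal.Quotient.eq_zero_iff_mem.mpr (Ideal.mem_span_singleton_self f)))

/-! ## Named facts: Theorem 5.4 (branched covers) -/

/-- NAMED FACT — **[Esentepe2020, Theorem 5.4, first sentence]**: «Let `R` and `R♯` be as above. Then
`π(ca(R♯)) ⊆ ca(R)`.»  Here `S = k⟦x₁,…,xₙ⟧ = MvPowerSeries (Fin n) k` over a field `k`, `f ∈ 𝔪_S`
(`constantCoeff f = 0`), `R♯ = S⟦y⟧ ⧸ (f + yᵐ)` the `m`-branched cover (`BranchedCover S f m`), `R = S ⧸ (f)`,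
`π = branchedCoverProjection S f m`, and `ca` the cohomology annihilator IDEAL (`Ideal.map` renders `π(ca(R♯))`).
Explicit hypotheses (typer's reading, see the module docstring): `2 ≤ m`, and `char k ≠ 2` (the running hypothesis
of §5.1 under which Remark 5.3 gives the weak MCM extending property of `π` for every `m`, whence the inclusion by
Theorem 5.1).  Users take `(h : branchedCover_map_cohomologyAnnihilator_le)`.
[cite: Esentepe2020, Theorem 5.4 (arXiv p. 9)] -/
def branchedCover_map_cohomologyAnnihilator_le : Prop :=
  ∀ (k : Type u) [Field k], ringChar k ≠ 2 → ∀ (n m : ℕ) [NeZero m], 2 ≤ m →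
    ∀ f : MvPowerSeries (Fin n) k, MvPowerSeries.constantCoeff f = 0 →
      (cohomologyAnnihilator (BranchedCover (MvPowerSeries (Fin n) k) f m)).map
          (branchedCoverProjection (MvPowerSeries (Fin n) k) f m) ≤
        cohomologyAnnihilator (MvPowerSeries (Fin n) k ⧸ Ideal.span {f})

/-- NAMED FACT — **[Esentepe2020, Theorem 5.4, second sentence]**: «When `m = 2`, there is equality», i.e.
`π(ca(R♯)) = ca(R)` for the DOUBLE branched cover `R♯ = S⟦y⟧ ⧸ (f + y²)` of `R = S ⧸ (f)`, `S = k⟦x₁,…,xₙ⟧`,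
`f ∈ 𝔪_S`.  Explicit hypotheses (typer's reading, see the module docstring): `char k ≠ 2` (the source's proof uses
Knörrer's Lemma 5.2, stated under «the characteristic of `k` is not `2`», and `y ∈ J_{R♯} ⊆ ca(R♯)` from
`∂(f + y²)/∂y = 2y`) and `f ≠ 0` (matrix factorisations of `f`).  Users take
`(h : doubleBranchedCover_map_cohomologyAnnihilator_eq)`. [cite: Esentepe2020, Theorem 5.4 (arXiv p. 9)] -/
def doubleBranchedCover_map_cohomologyAnnihilator_eq : Prop :=
  ∀ (k : Type u) [Field k], ringChar k ≠ 2 → ∀ (n : ℕ) (f : MvPowerSeries (Fin n) k),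
    MvPowerSeries.constantCoeff f = 0 → f ≠ 0 →
      (cohomologyAnnihilator (BranchedCover (MvPowerSeries (Fin n) k) f 2)).map
          (branchedCoverProjection (MvPowerSeries (Fin n) k) f 2) =
        cohomologyAnnihilator (MvPowerSeries (Fin n) k ⧸ Ideal.span {f})

/-! ## Named fact: Theorem 4.4 (reduced curve singularities), plane-curve case -/

/-- NAMED FACT — **[Esentepe2020, Theorem 4.4]**: «Let `R` be a one dimensional reduced complete Gorenstein local
ring. Then `ca(R) = 𝔠(R)`» (`𝔠(R) = ann(R̄/R)` the conductor, `R̄` the integral closure of `R` in its total quotient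
ring; proof in the source: `ca ⊆ 𝔠` by Lemma 2.3 / Cor. 4.2, `𝔠 ⊆ ca` by Wang's Theorem 4.3).  TYPED IN THE SPECIAL
CASE of reduced PLANE CURVE germs `R = k⟦z,t⟧ ⧸ (h)`, `0 ≠ h ∈ 𝔪` (a hypersurface in the complete regular local ring
`k⟦z,t⟧ = MvPowerSeries (Fin 2) k`, hence a one-dimensional complete Gorenstein local ring), with
`𝔠(R) = conductorIdeal R R̄`, `R̄ = integralClosure R (FractionRing R)`.
-- TODO(general form): every one-dimensional reduced complete Gorenstein local ring (the tree has no Gorenstein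
-- predicate; Wang's Theorem 4.3 — `𝔠(R)·Ext¹(M, N) = 0` for `M` maximal Cohen–Macaulay over a one-dimensional
-- reduced complete local ring — is likewise not typed for want of an MCM predicate).
Users take `(h : planeCurve_cohomologyAnnihilator_eq_conductor)`. [cite: Esentepe2020, Theorem 4.4 (arXiv p. 7)] -/
def planeCurve_cohomologyAnnihilator_eq_conductor : Prop :=
  ∀ (k : Type u) [Field k] (h : MvPowerSeries (Fin 2) k), MvPowerSeries.constantCoeff h = 0 → h ≠ 0 →
    IsReduced (MvPowerSeries (Fin 2) k ⧸ Ideal.span {h}) →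
      cohomologyAnnihilator (MvPowerSeries (Fin 2) k ⧸ Ideal.span {h}) =
        Literature.RingTheory.KTheory.conductorIdeal (MvPowerSeries (Fin 2) k ⧸ Ideal.span {h})
          ↥(integralClosure (MvPowerSeries (Fin 2) k ⧸ Ideal.span {h})
              (FractionRing (MvPowerSeries (Fin 2) k ⧸ Ideal.span {h})))

end Literature.RingTheory.CohomologyAnnihilator

end
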